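import Summits.BirchSwinnertonDyer.BirchSwinnertonDyer.Theorems.PrintCf2DisegniPairTwoTamePeriodTransportNeg
import Summits.BirchSwinnertonDyer.BirchSwinnertonDyer.Theorems.PrintCf2DisegniPairTwoTamePeriodTransportCm7
import Summits.BirchSwinnertonDyer.BirchSwinnertonDyer.Theorems.PrintCf2DisegniPairTwoRealComponents
import Summits.BirchSwinnertonDyer.BirchSwinnertonDyer.Theorems.ThetaPartnerAtTwoSignedMainConjectureCMTwoRankZeroFlatTwistMinusUnit
import HarnessLib

/-!
# Road (C) `disegni-pair-two` on crux stmt-BirchSwinnertonDyer-20368 — the `χ₈`-class defect key in `cm7`-currency for a NEGATIVE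
# twist parameter: NO period-ratio class constant (`μ(cm7) = 1` from the anchor print and `Δ(cm7) < 0`, `c_∞(cm7) = 1`, `u(C₀) = ±1`)

Cell `bsd-print-cf2`, width seat `bsd-line-cf2-p1-w8` g24; the `d < 0` twin of `PrintCf2DisegniPairTwoTamePeriodTransportCm7.lean`,
sequel of `PrintCf2DisegniPairTwoTamePeriodTransportNeg.lean` (`defectKey_chi8_base_currency_neg`). `--supports
stmt-BirchSwinnertonDyer-20368` (helper). THEOREMS ONLY (no `def`, no named fact, no `sorry`); conditional on every displayed
hypothesis — among them the ANCHOR PRINT `OptimalCurveManinCertificate cm7` and modularity `exists_isNewformOf`. BSD is not proved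
by any of this; no summit statement is claimed; 20368 is not closed here.

## What is proved

* §1 `imaginaryPeriodRat_cm7_eq_minusPeriod` — GRANTED `OptimalCurveManinCertificate cm7`: `|Ω⁻(cm7)| = Ω⁻_{f_{cm7}}` (`μ(cm7) = 1`;
  the lattice clause with `|c| = 1` and `Δ(cm7) = −7³ < 0`, tree
  `FlatTwist.Imaginary.imaginaryPeriodRat_eq_abs_mul_minusPeriod_of_latticeEq`); `padicValRat_numRealComponents_cm7`
  (`c_∞(cm7) = 1`).
* §2 ★★★ `defectKey_chi8_cm7_currency_neg` — for a globally minimal member `W` of the `χ₈`-class over `V = C₀ • cm7^{(d)}` with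
  `d < 0`, `d ≡ 1 (4)`, squarefree, prime to `7`: `D_{G⁻} ≠ 0 ∧ shaAn W = q ∈ ℚˣ ∧ v₂(q) + v₂(Tam W) + v₂(h₂) = v₂(D_{G⁻}) + 2 + 2v₂(#W(ℚ)_tors)`,
  `G⁻ = L⁻₂(f_{cm7}, |d|, α_{cm7}, χ_d, ·)` the `χ_d`-twisted `2`-adic `L`-function of the MINUS tame measure of the level-`49` form —
  **no class constant**. With `defectKey_chi8_cm7_currency` (`d > 0`) the `stub_classConstants_two` content of the WHOLE `χ₈`-class
  (members `cm7^{(2d)}`, `7 ∤ d`) is discharged by name.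
* §3 ★★★ `padicValRat_shaAn_eq_of_descentLaw_cm7_neg` — DK by `linear_combination` GRANTED the (Δ1′⁻) descent law
  `v₂(D_{G⁻}) − v₂(h₂) = s₂ + v₂(Tam W) − 2v₂(#tors) − 2` (explicit hypothesis; research stub): `v₂(shaAn W) = s₂`.

References: B. Mazur, J. Tate, J. Teitelbaum, Invent. Math. 84 (1986) §I.8 [MazurTateTeitelbaum1986Invent]; V. Pal, Proc. AMS 140
(2012) Prop. 2.5, Thm. 3.2 [Pal2012]; A. Agashe, K. Ribet, W. A. Stein, PAMQ 2 (2006) Thm. 2.6 and appendix [AgasheRibetStein2006];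
B. Edixhoven, Progr. Math. 89 (1991) Prop. 2 [EdixhovenManin1991]; D. Disegni, Compos. Math. 153 (2017) Thm. B [Disegni2017].
-/

set_option autoImplicit false
set_option linter.dupNamespace false

noncomputable section

open scoped Classical MatrixGroups ModularForm NumberField NumberTheorySymbols

open CongruenceSubgroup NumberField IsDedekindDomain WeierstrassCurve WeierstrassCurve.Affine.Point PowerSeries
  Rat.HeightOneSpectrum
  Literature.NumberTheory.EllipticCurves Literature.NumberTheory.EllipticCurves.ModularForms
  Literature.NumberTheory.EllipticCurves.Disegni2017 Literature.NumberTheory.GaloisRepresentations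
  Literature.NumberTheory.EllipticCurves.GreenbergVatsal2000 Summit.BirchSwinnertonDyer.Rank1Residual.AdditivePotMult
  Summit.BirchSwinnertonDyer.BirchSwinnertonDyer.Theorems.FlatTwist.Imaginary

namespace Summit.BirchSwinnertonDyer.BirchSwinnertonDyer.Theorems.PrintCf2.DisegniPairTwo

/-! ### §1 The base `cm7`: `μ(cm7) = 1`, `c_∞(cm7) = 1` -/

section Cm7Neg

/-- **`μ(cm7) = 1`: `|Ω⁻(cm7)| = Ω⁻_{f}` for the newform `f` of `cm7` at level `N(cm7)`**, GRANTED the anchor print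
`OptimalCurveManinCertificate cm7`: the optimal datum `D₀` has `Λ_{cm7} = c·Λ_f` with `|c| = 1`, and `Δ(cm7) = −7³ < 0` (rhombic
lattice), so `|Ω⁻(cm7)| = |c|·Ω⁻_f = Ω⁻_f` (`imaginaryPeriodRat_eq_abs_mul_minusPeriod_of_latticeEq`); `f = D₀.f` by `q`-expansion
uniqueness. [cite: AgasheRibetStein2006, Thm. 2.6 and appendix §5] [cite: EdixhovenManin1991, Prop. 2]
[cite: CremonaAlgorithms1997, Table 1 (49a1) and §2.8] -/
theorem imaginaryPeriodRat_cm7_eq_minusPeriod [cm7.IsGloballyMinimal] (hM : OptimalCurveManinCertificate cm7)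
    [NeZero (cm7.conductorNorm ℤ)] {fE : CuspForm (Gamma0 (cm7.conductorNorm ℤ)) 2} (hfE : IsNewformOf cm7 fE) :
    ((1 : ℚ) : ℝ) * cm7.imaginaryPeriodRat = minusPeriod fE := by
  obtain ⟨hN, D₀, hopt, hc1, -⟩ := hM.exists_optimalDatum_abs_maninConstant_eq_one
  have hΔ : ¬ 0 < cm7.Δ := by rw [Δ_cm7]; norm_num
  have hΩ := imaginaryPeriodRat_eq_abs_mul_minusPeriod_of_latticeEq D₀ hopt hΔ
  have hc1' : |(D₀.c : ℝ)| = 1 := by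
    have h : |D₀.c| = 1 := hc1
    exact_mod_cast h
  have hf : fE = D₀.f := hfE.unique D₀.isNewformOf
  rw [Rat.cast_one, one_mul, hΩ, hc1', one_mul, hf]

/-- **`c_∞(cm7) = 1`** (`Δ(cm7) = −7³ < 0`), in valuation form: `v₂(c_∞(cm7)) = 0`. [cite: CremonaAlgorithms1997, Table 1 (49a1) and §3.7] -/
theorem padicValRat_numRealComponents_cm7 : padicValRat 2 ((cm7.baseChange ℝ).numRealComponents : ℚ) = 0 := by
  rw [numRealComponents_eq_one_of_Δ_neg cm7 (by rw [Δ_cm7]; norm_num)]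
  simp

end Cm7Neg

variable (ι : PadicAlgCl 2 ≃+* ℂ) (K : Type) [Field K] [NumberField K] [IsGalois ℚ K]

/-! ### §2 The `χ₈`-class defect key in `cm7`-currency, negative twist parameter -/

/-- ★★★ **The defect key of the `χ₈∘N`-class MODULO (Δ1), in `cm7`-currency, NEGATIVE twist parameter, with NO class constant.**
Frame of `defectKey_chi8_modulo_descent_min` for a globally minimal member `W` over the good curve `V = C₀ • cm7^{(d)}` (`d < 0`,
`d ≡ 1 (mod 4)`, squarefree, prime to `7`), GRANTED the anchor print `OptimalCurveManinCertificate cm7` and modularity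
`exists_isNewformOf`: with `G⁻ = L⁻₂(f_{cm7}, |d|, α_{cm7}, χ_d, ·)` (`padicLFunctionTameMinus`) and `D_{G⁻} = Σ_k k[T^k]G⁻(−2)^{k−1}`,
`D_{G⁻} ≠ 0 ∧ shaAn W = q ∈ ℚˣ ∧ v₂(q) + v₂(Tam W) + v₂(h₂) = v₂(D_{G⁻}) + 2 + 2v₂(#W(ℚ)_tors)`.
[cite: Disegni2017, Theorem B] [cite: MazurTateTeitelbaum1986Invent, §I.8 and §I.13] [cite: Pal2012, Prop. 2.5, Thm. 3.2 (case d < 0)]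
[cite: AgasheRibetStein2006, Thm. 2.6 and appendix §5] -/
theorem defectKey_chi8_cm7_currency_neg (hGZ73 : GrossZagier1986_thm_I_7_3) (h2 : Module.finrank ℚ K = 2)
    (hsplit : ((Ideal.span {(2 : ℤ)}).primesOver (𝓞 K)).ncard = 2)
    (𝔭 𝔭' : HeightOneSpectrum (𝓞 K)) (h𝔭 : ((2 : ℕ) : 𝓞 K) ∈ 𝔭.asIdeal)
    (h𝔭' : ((2 : ℕ) : 𝓞 K) ∈ 𝔭'.asIdeal)
    (κ : DirichletCharacter ℂ (NumberField.discr K).natAbs)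
    (hκ : ∀ ℓ : ℕ, ℓ.Prime → ℓ ≠ 2 → κ ℓ = (jacobiSym (NumberField.discr K) ℓ : ℂ))
    (hκ2 : κ 2 = if NumberField.discr K % 8 = 1 then 1 else if NumberField.discr K % 8 = 5 then -1 else 0)
    (hd : Nat.Coprime 2 (NumberField.discr K).natAbs)
    -- the base `cm7`: anchor print, newform, and the twist parameter `d`
    [cm7.IsGloballyMinimal] [NeZero (cm7.conductorNorm ℤ)] (hM : OptimalCurveManinCertificate cm7)
    {fE : CuspForm (Gamma0 (cm7.conductorNorm ℤ)) 2} (hfE : IsNewformOf cm7 fE)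
    (hmodf : exists_isNewformOf) {d : ℤ} [NeZero d.natAbs] (hd0 : d < 0) (hd4 : d % 4 = 1) (hsq : Squarefree d)
    (hcop : IsCoprime d (cm7.conductorNorm ℤ : ℤ)) (h7 : ¬ (7 : ℤ) ∣ d) {χJ : MulChar (ZMod d.natAbs) ℤ}
    (hχJ : ∀ a : ZMod d.natAbs, χJ a = J((a.val : ℤ) | d.natAbs))
    -- the good pair over `V = C₀ • cm7^{(d)}`
    (V V' : WeierstrassCurve ℚ) [V.IsElliptic] [V.IsGloballyMinimal] [V'.IsElliptic] [V'.IsGloballyMinimal]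
    [NeZero (V.conductorNorm ℤ)] {C₀ : VariableChange ℚ} (hV : C₀ • cm7.quadraticTwist (d : ℚ) = V)
    (hordV' : IsOrdinaryAt V' 2) (hap : V'.frobeniusTrace 2 = V.frobeniusTrace 2)
    {N' : ℕ} [NeZero N'] {f : CuspForm (Gamma0 (V.conductorNorm ℤ)) 2}
    {f' : CuspForm (Gamma0 N') 2} (hfV : IsNewformOf V f) (hfV' : IsNewformOf V' f')
    (hV' : ∀ n : ℕ, cuspCoeff f' n = κ (n : ZMod _) * cuspCoeff f n)
    (h0 : HasSum (fun k : ℕ ↦ PowerSeries.coeff k (padicLFunction f (unitRoot V 2 : ℚ_[2])) *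
      (-2 : ℚ_[2]) ^ k) 0)
    -- the member (analytic rank one, rank one) and its companion
    (hmod : hasEntireLFunction_rat) {M M' : ℕ} [NeZero M] [NeZero M']
    {g : CuspForm (Gamma0 M) 2} {g' : CuspForm (Gamma0 M') 2}
    (W W' : WeierstrassCurve ℚ) [W.IsElliptic] [W.IsGloballyMinimal] [W'.IsElliptic]
    (hg : IsNewformOf W g) (hg' : IsNewformOf W' g')
    (hgε : ∀ m : ℕ, cuspCoeff g m = (ZMod.χ₈.ringHomComp (Int.castRingHom ℂ)) m * cuspCoeff f m)
    (hg'ε : ∀ m : ℕ, cuspCoeff g' m = (ZMod.χ₈.ringHomComp (Int.castRingHom ℂ)) m * cuspCoeff f' m)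
    (hr : W.analyticRank = 1) (hrk : W.mordellWeilRank = 1) (hL' : W'.entireLFunction 1 ≠ 0)
    -- the tower frame and the sign character
    {H : Type} [Field H] [NumberField H] [Algebra K H] (hKH : Module.finrank K H = 2) {t : H}
    (htK : t ∉ Set.range (algebraMap K H)) (ht2 : t ^ 2 = algebraMap ℚ H 2)
    (G : Subgroup (H ≃ₐ[ℚ] H)) (χ : G →* ℂˣ) (s : G → ℤ) (hs : ∀ σ, ((χ σ : ℂˣ) : ℂ) = (s σ : ℂ))
    (τ : H ≃ₐ[ℚ] H) (hτG : τ ∈ G) (hsτ : s ⟨τ, hτG⟩ = -1)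
    (hτK : ∀ a : K, τ (algebraMap K H a) = algebraMap K H a) (hτt : τ t = -t)
    {u : K} {e : ℚ} (hu : u ∉ Set.range (algebraMap ℚ K)) (hue : u ^ 2 = algebraMap ℚ K e)
    (c : K ≃ₐ[ℚ] K) (hcu : c u = -u)
    -- the member's explicit model `V^{(2)} = C • W` and its Mordell–Weil generator
    [(V.quadraticTwist 2).IsElliptic] {C : VariableChange ℚ} (hC : C • W = V.quadraticTwist 2)
    {P : (V.quadraticTwist 2).toAffine.Point}
    (hgen : ∀ R : (V.quadraticTwist 2).toAffine.Point,
      ∃ (k : ℤ) (T : (V.quadraticTwist 2).toAffine.Point), IsOfFinAddOrder T ∧ R = k • P + T)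
    (htors : ∀ Q : ((V.quadraticTwist 2).quadraticTwist e).toAffine.Point, IsOfFinAddOrder Q)
    -- Disegni's datum: invariance, PIN, and the conjoined clauses (PRINT stub of the road)
    (DH : PAdicHeightDataK V 2 H)
    (hDH : ∀ (σ : G) (a b : (V.baseChange H).toAffine.Point),
      DH.pairing (pointGalHom V H σ.1 a) (pointGalHom V H σ.1 b) = DH.pairing a b)
    {h₂ : ℚ_[2]}
    (hpin : DH.pairing
      (twistPointEquivOver V (not_mem_range_rat_of_not_mem_range htK) ht2
        (QuadraticDescent.incl H (V.quadraticTwist 2) P))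
      (twistPointEquivOver V (not_mem_range_rat_of_not_mem_range htK) ht2
        (QuadraticDescent.incl H (V.quadraticTwist 2) P)) = h₂)
    (hGZ : ChiLineGrossZagierClauses ι K V H f (ι (((unitRoot V 2 : ℚ_[2]) : PadicAlgCl 2)))
      (baseChangeDirichlet K (ZMod.χ₈.ringHomComp (Int.castRingHom ℂ))) 𝔭 𝔭' G χ DH)
    -- Bertrand: the 2-adic height of the member's generator is non-zero
    (hh₂ : h₂ ≠ 0) :
    (∑' k : ℕ, PowerSeries.coeff k (padicLFunctionTameMinus fE d.natAbs (unitRoot cm7 2 : ℚ_[2])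
            ((χJ.ringHomComp (Int.castRingHom ℚ)).ringHomComp (Rat.castHom ℚ_[2]))) * (k : ℚ_[2]) *
              (-2) ^ (k - 1)) ≠ 0 ∧
    ∃ q : ℚ, shaAn W = (q : ℂ) ∧ q ≠ 0 ∧
      padicValRat 2 q + (padicValNat 2 W.tamagawaProduct : ℤ) + h₂.valuation =
        (∑' k : ℕ, PowerSeries.coeff k (padicLFunctionTameMinus fE d.natAbs (unitRoot cm7 2 : ℚ_[2])
            ((χJ.ringHomComp (Int.castRingHom ℚ)).ringHomComp (Rat.castHom ℚ_[2]))) * (k : ℚ_[2]) *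
              (-2) ^ (k - 1)).valuation + 2 +
          2 * (padicValNat 2 W.torsionOrder : ℤ) := by
  have hordE : IsOrdinaryAt cm7 2 := ⟨cm7_hasGoodReductionAtPrime_two, cm7_not_two_dvd_frobeniusTrace_two⟩
  have hμE := imaginaryPeriodRat_cm7_eq_minusPeriod hM hfE
  obtain ⟨hDG, q, hq, hq0, hv⟩ := defectKey_chi8_base_currency_neg ι K hGZ73 h2 hsplit 𝔭 𝔭' h𝔭 h𝔭' κ hκ hκ2 hd cm7 hfE
    hordE hmodf hd0 hd4 hsq hcop hχJ one_ne_zero hμE V V' hV hordV' hap hfV hfV' hV' h0 hmod W W' hg hg' hgε hg'ε hr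
    hrk hL' hKH htK ht2 G χ s hs τ hτG hsτ hτK hτt hu hue c hcu hC hgen htors DH hDH hpin hGZ hh₂
  have hu0 : padicValRat 2 (C₀.u : ℚ) = 0 := padicValRat_u_cm7_twist_eq_zero hd4 hsq h7 V hV
  refine ⟨hDG, q, hq, hq0, ?_⟩
  rw [hu0, add_zero, padicValRat_numRealComponents_cm7, add_zero, padicValRat.one, add_zero] at hv
  exact hv

/-! ### §3 DK by omega from the descent law in `cm7`-currency (negative twist parameter) -/

/-- ★★★ **The `χ₈`-class defect key (negative twist parameter) CLOSES by linear arithmetic from the descent law in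
`cm7`-currency.** In the frame of `defectKey_chi8_cm7_currency_neg`, suppose the (Δ1′⁻) DESCENT LAW for `W` read on the
`χ_d`-twisted `2`-adic `L`-function of the MINUS tame measure of the level-`49` form:
`v₂(D_{G⁻}) − v₂(h₂) = s₂ + v₂(Tam W) − 2·v₂(#W(ℚ)_tors) − 2` (`s₂ ∈ ℤ`; in the road `s₂ = v₂(#Ш(W)[2^∞])`). Then
`shaAn W = q ∈ ℚˣ` with `v₂(q) = s₂`. (Δ1′⁻) is the road's research stub; nothing here asserts it.
[cite: Disegni2017, Theorem B] [cite: MazurTateTeitelbaum1986Invent, §I.8 and §I.13] [cite: PerrinRiou1987, §1] -/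
theorem padicValRat_shaAn_eq_of_descentLaw_cm7_neg (hGZ73 : GrossZagier1986_thm_I_7_3) (h2 : Module.finrank ℚ K = 2)
    (hsplit : ((Ideal.span {(2 : ℤ)}).primesOver (𝓞 K)).ncard = 2)
    (𝔭 𝔭' : HeightOneSpectrum (𝓞 K)) (h𝔭 : ((2 : ℕ) : 𝓞 K) ∈ 𝔭.asIdeal)
    (h𝔭' : ((2 : ℕ) : 𝓞 K) ∈ 𝔭'.asIdeal)
    (κ : DirichletCharacter ℂ (NumberField.discr K).natAbs)
    (hκ : ∀ ℓ : ℕ, ℓ.Prime → ℓ ≠ 2 → κ ℓ = (jacobiSym (NumberField.discr K) ℓ : ℂ))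
    (hκ2 : κ 2 = if NumberField.discr K % 8 = 1 then 1 else if NumberField.discr K % 8 = 5 then -1 else 0)
    (hd : Nat.Coprime 2 (NumberField.discr K).natAbs)
    -- the base `cm7`: anchor print, newform, and the twist parameter `d`
    [cm7.IsGloballyMinimal] [NeZero (cm7.conductorNorm ℤ)] (hM : OptimalCurveManinCertificate cm7)
    {fE : CuspForm (Gamma0 (cm7.conductorNorm ℤ)) 2} (hfE : IsNewformOf cm7 fE)
    (hmodf : exists_isNewformOf) {d : ℤ} [NeZero d.natAbs] (hd0 : d < 0) (hd4 : d % 4 = 1) (hsq : Squarefree d)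
    (hcop : IsCoprime d (cm7.conductorNorm ℤ : ℤ)) (h7 : ¬ (7 : ℤ) ∣ d) {χJ : MulChar (ZMod d.natAbs) ℤ}
    (hχJ : ∀ a : ZMod d.natAbs, χJ a = J((a.val : ℤ) | d.natAbs))
    -- the good pair over `V = C₀ • cm7^{(d)}`
    (V V' : WeierstrassCurve ℚ) [V.IsElliptic] [V.IsGloballyMinimal] [V'.IsElliptic] [V'.IsGloballyMinimal]
    [NeZero (V.conductorNorm ℤ)] {C₀ : VariableChange ℚ} (hV : C₀ • cm7.quadraticTwist (d : ℚ) = V)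
    (hordV' : IsOrdinaryAt V' 2) (hap : V'.frobeniusTrace 2 = V.frobeniusTrace 2)
    {N' : ℕ} [NeZero N'] {f : CuspForm (Gamma0 (V.conductorNorm ℤ)) 2}
    {f' : CuspForm (Gamma0 N') 2} (hfV : IsNewformOf V f) (hfV' : IsNewformOf V' f')
    (hV' : ∀ n : ℕ, cuspCoeff f' n = κ (n : ZMod _) * cuspCoeff f n)
    (h0 : HasSum (fun k : ℕ ↦ PowerSeries.coeff k (padicLFunction f (unitRoot V 2 : ℚ_[2])) *
      (-2 : ℚ_[2]) ^ k) 0)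
    -- the member (analytic rank one, rank one) and its companion
    (hmod : hasEntireLFunction_rat) {M M' : ℕ} [NeZero M] [NeZero M']
    {g : CuspForm (Gamma0 M) 2} {g' : CuspForm (Gamma0 M') 2}
    (W W' : WeierstrassCurve ℚ) [W.IsElliptic] [W.IsGloballyMinimal] [W'.IsElliptic]
    (hg : IsNewformOf W g) (hg' : IsNewformOf W' g')
    (hgε : ∀ m : ℕ, cuspCoeff g m = (ZMod.χ₈.ringHomComp (Int.castRingHom ℂ)) m * cuspCoeff f m)
    (hg'ε : ∀ m : ℕ, cuspCoeff g' m = (ZMod.χ₈.ringHomComp (Int.castRingHom ℂ)) m * cuspCoeff f' m)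
    (hr : W.analyticRank = 1) (hrk : W.mordellWeilRank = 1) (hL' : W'.entireLFunction 1 ≠ 0)
    -- the tower frame and the sign character
    {H : Type} [Field H] [NumberField H] [Algebra K H] (hKH : Module.finrank K H = 2) {t : H}
    (htK : t ∉ Set.range (algebraMap K H)) (ht2 : t ^ 2 = algebraMap ℚ H 2)
    (G : Subgroup (H ≃ₐ[ℚ] H)) (χ : G →* ℂˣ) (s : G → ℤ) (hs : ∀ σ, ((χ σ : ℂˣ) : ℂ) = (s σ : ℂ))
    (τ : H ≃ₐ[ℚ] H) (hτG : τ ∈ G) (hsτ : s ⟨τ, hτG⟩ = -1)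
    (hτK : ∀ a : K, τ (algebraMap K H a) = algebraMap K H a) (hτt : τ t = -t)
    {u : K} {e : ℚ} (hu : u ∉ Set.range (algebraMap ℚ K)) (hue : u ^ 2 = algebraMap ℚ K e)
    (c : K ≃ₐ[ℚ] K) (hcu : c u = -u)
    -- the member's explicit model `V^{(2)} = C • W` and its Mordell–Weil generator
    [(V.quadraticTwist 2).IsElliptic] {C : VariableChange ℚ} (hC : C • W = V.quadraticTwist 2)
    {P : (V.quadraticTwist 2).toAffine.Point}
    (hgen : ∀ R : (V.quadraticTwist 2).toAffine.Point,
      ∃ (k : ℤ) (T : (V.quadraticTwist 2).toAffine.Point), IsOfFinAddOrder T ∧ R = k • P + T)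
    (htors : ∀ Q : ((V.quadraticTwist 2).quadraticTwist e).toAffine.Point, IsOfFinAddOrder Q)
    -- Disegni's datum: invariance, PIN, and the conjoined clauses (PRINT stub of the road)
    (DH : PAdicHeightDataK V 2 H)
    (hDH : ∀ (σ : G) (a b : (V.baseChange H).toAffine.Point),
      DH.pairing (pointGalHom V H σ.1 a) (pointGalHom V H σ.1 b) = DH.pairing a b)
    {h₂ : ℚ_[2]}
    (hpin : DH.pairing
      (twistPointEquivOver V (not_mem_range_rat_of_not_mem_range htK) ht2
        (QuadraticDescent.incl H (V.quadraticTwist 2) P))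
      (twistPointEquivOver V (not_mem_range_rat_of_not_mem_range htK) ht2
        (QuadraticDescent.incl H (V.quadraticTwist 2) P)) = h₂)
    (hGZ : ChiLineGrossZagierClauses ι K V H f (ι (((unitRoot V 2 : ℚ_[2]) : PadicAlgCl 2)))
      (baseChangeDirichlet K (ZMod.χ₈.ringHomComp (Int.castRingHom ℂ))) 𝔭 𝔭' G χ DH)
    -- Bertrand: the 2-adic height of the member's generator is non-zero
    (hh₂ : h₂ ≠ 0)
    -- the (Δ1′⁻) descent law in `cm7`-currency (research stub of the road; an explicit hypothesis here)
    (s₂ : ℤ)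
    (hΔ1 : (∑' k : ℕ, PowerSeries.coeff k (padicLFunctionTameMinus fE d.natAbs (unitRoot cm7 2 : ℚ_[2])
            ((χJ.ringHomComp (Int.castRingHom ℚ)).ringHomComp (Rat.castHom ℚ_[2]))) * (k : ℚ_[2]) *
              (-2) ^ (k - 1)).valuation - h₂.valuation =
      s₂ + (padicValNat 2 W.tamagawaProduct : ℤ) - 2 * (padicValNat 2 W.torsionOrder : ℤ) - 2) :
    ∃ q : ℚ, shaAn W = (q : ℂ) ∧ q ≠ 0 ∧ padicValRat 2 q = s₂ := by
  obtain ⟨-, q, hq, hq0, hv⟩ := defectKey_chi8_cm7_currency_neg ι K hGZ73 h2 hsplit 𝔭 𝔭' h𝔭 h𝔭' κ hκ hκ2 hd hM hfE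
    hmodf hd0 hd4 hsq hcop h7 hχJ V V' hV hordV' hap hfV hfV' hV' h0 hmod W W' hg hg' hgε hg'ε hr hrk hL' hKH htK ht2 G χ s
    hs τ hτG hsτ hτK hτt hu hue c hcu hC hgen htors DH hDH hpin hGZ hh₂
  exact ⟨q, hq, hq0, by linear_combination hv + hΔ1⟩

end Summit.BirchSwinnertonDyer.BirchSwinnertonDyer.Theorems.PrintCf2.DisegniPairTwo

end
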